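/-
Copyright (c) 2026 the pub-hodgecm-mathlib formalisation cell (harness21).  Prover seat hodgecm-mathlib-LH4-p15 (g0), req620 Track A «(D-RAM) FOUR-FRAME» squad
((β₂) road (R-36) «PURE-CELL LEDGER»; β₂-BOARD HANDOFF-beta2cells v1 (LH4-p04 (g8)) §OPEN «hdich at shallow axis levels (p15 face)»; (AX-sh) toolkit for the `hdich`
binder of ★ p862003 `F0P3cDyRamAxisColumnZero` (LH4-p12 (g8)) on the whole axis column), 2026-09-04.
-/
import Summits.HodgeConjecture.HodgeConjecture.Theorems.F0P3cDyRamValueSetSkewLineCriterion    -- ★ (L-lab-8) (F0P3a lineage): brings ★ `WildQuadraticDatumTrace` (`v_add_map_le_exp`, `map_varpi_ne`, `v_varpi_pow`), ★ `WildQuadraticEisensteinFrame` (`exists_fixed_coords_of_map_ne`, `v_fixed_add_fixed_mul_eq_max`)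
import Summits.HodgeConjecture.HodgeConjecture.Theorems.F0P3cDyRamToricCensusDefs               -- ★ DEFS (LH4-p04 lineage): `IsOrd`, `isOrd_iff`
import Literature.NumberTheory.Automorphic.UnitaryLatticeTreeTypeTwoHyperbolic                 -- ★ `eq_one_of_mul_self_eq_one` (in `ℤᵐ⁰`)
import HarnessLib

/-!
# Crux `H413`, line LH4 «(D-RAM) FOUR-FRAME» — STAGE-1b, row (2), the (β₂) road (R-36), row (AX-sh) TOOLKIT: the skew gain of the ramified datum, `ρ`-fixed coordinates
# of an order element, the `κ` of a unimodular line, the expansion of a value against its ray value, the depth trace, and the three shell tokens read as sizes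

Cell `hodgecm-mathlib` (D-0151), FLOOR 0, crux item H413 = `stmt-HodgeConjecture-24833`, route of record `HCCMUnconditional`; squad F0∕P3c∕LH4; lane
`--supports stmt-HodgeConjecture-24833 --as helper` (count-neutral; pays NO tier-0 row).  THEOREMS ONLY (no `def`, no instance, no notation, no `sorry`, default heartbeats);
★-only imports; states NO law.  DATUM-FREE over the line-model letters of ★ (C1) ∕ ★ DEFS `F0P3cDyRamToricCensusDefs` (`M ⊇ jE(E)`, `ρ` with `Fix ρ = jE(E)`, `Θ` with
`Θ ∘ jE = jE ∘ σ`, the integral generator `α`, the order `𝒪_j = {IsOrd ρ α cc ·}`) and the sheet datum `IsRamifiedQuadraticDatum σ ϖ d t` on `E`.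

WHY (HANDOFF-beta2cells v1 (LH4-p04 (g8), 61f6486f) §OPEN; LH4-p04 16:28:43Z (AX-sh); LH4-p13 (g8) 16:24:27Z).  The consumer ★-file `F0P3cDyRamAxisLetterEstimates` proves that the
`m*`-letter of a unimodular axis line on the clean shell is ONE class at every order level (the `hdich` binder of ★ p862003); this file holds its algebra and its size
bookkeeping, each a few lines:
* §1 `v_sub_map_le_mul_of_datum` — THE SKEW GAIN `|x − σx| ≤ |x|·|ϖ|^{d−1}` of a ramified quadratic datum (`x = a + bϖ` with `σ`-fixed `a, b`: ★ `exists_fixed_coords_of_map_ne`,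
  ★ `v_fixed_add_fixed_mul_eq_max`), its `ρ`-fixed image in the line model `v_sub_map_le_mul_of_fixed`, and two facts of `ℤᵐ⁰`.
* §2 the `ρ`-fixed coordinates `ζ = A + B·α`, `B = (ζ − ρζ)∕(α − ρα)`: `coords_fixed`, `v_coords_le` (`ζ ∈ 𝒪_j ⇒ |B| ≤ |cc|, |A| ≤ 1`), `isOrd_of_coords`, `isOrd_of_fixed`.
* §3 the `κ` of a unimodular line (`|κ + ρκ| ≤ 1`, `|κ|·|cc| = 1`): `v_trace_mul_alpha_eq` (`|Tr_ρ(κα)| = |κ|`), `v_trace_mul_le_one_of_isOrd` (`Tr_ρ(κ·𝒪_j)` integral).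
* §4 `value_sub_ray_eq` (`Tr_ρ(c·ζΘζ) − AΘA·Tr_ρ c = BΘA·Tr_ρ(cα) + AΘB·Tr_ρ(cΘα) + BΘB·Tr_ρ(cαΘα)`), `cross_regroup`, `map_trace_mul_eq`, `sum_traces_eq`, the DEPTH TRACE
  `depth_add_map_eq` (`c + Θc = κ((lam − 1)²∕lam − jE Tr_σ(u₀ − 1))` for `c = κ(lam − jE u₀)`, `N_Θ lam = 1`), and the token readings `v_kappa_eq`, `v_sub_one_le_of_sq`
  (square token ⇒ `|lam − 1| ≤ exp(−k)`), `v_depth_le`, `v_lam_eq_one`, `v_sub_map_le_of_isOrd` (level token ⇒ `|w − ρw| ≤ exp(−(ℓ + j))`), `lower_token_read` (NOT level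
  `ℓ + 1` ⇒ `|w − ρw| > exp(−(ℓ + 1 + j))`, hence `k ≤ j + ℓ`).
HONEST LABEL.  Count-neutral line-model algebra; nothing printed is asserted; no census law is stated; `HC_CM` is proved only modulo the 7 printed citations (2 remaining named
inputs: hLiu418 = `stmt-HodgeConjecture-24832`, h413 = `stmt-HodgeConjecture-24833`) until rung 0 closes.
## References
* [Serre1979] J.-P. Serre, *Local Fields*, GTM 67 (1979): Ch. III §3 Prop. 7 (trace images), Ch. III §6 Prop. 12–13 (orders of conductor `c`; the different of a ramified
  quadratic extension), Ch. V §3 Cor. 3.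
* [Jacobowitz1962] R. Jacobowitz, *Hermitian forms over local fields*, Amer. J. Math. 84 (1962): §4 (unimodular hermitian lines over an order of the quadratic extension).
* [Rogawski1990] J. D. Rogawski, *Automorphic Representations of Unitary Groups in Three Variables*, Ann. of Math. Stud. 123 (1990): §4.9 Prop. 4.9.1 (b) p. 55.
* [Kottwitz1986BaseChangeUnits] R. E. Kottwitz, *Base change for unit elements of Hecke algebras*, Compositio Math. 60 (1986): §1 pp. 240–241.
-/

set_option autoImplicit false

noncomputable section

namespace Summit.HodgeConjecture.HodgeConjecture.Cruxes.H413.F0P3cDyRamAxisLetterToolkit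

open scoped Valued WithZero
open WithZero
open Literature.NumberTheory.Automorphic.UnitaryThreeFourFrame (IsRamifiedQuadraticDatum)
open Literature.NumberTheory.LocalFields (exists_fixed_coords_of_map_ne v_fixed_add_fixed_mul_eq_max)
open Literature.NumberTheory.LocalFields.WildQuadraticDatum
open Summit.HodgeConjecture.HodgeConjecture.Cruxes.H413.F0P3cDyRamToricCensusDefs


/-! ## §1 The skew gain of a ramified quadratic datum, and two facts of `ℤᵐ⁰` -/

section Datum

variable {E : Type} [Field E] [Valued E ℤᵐ⁰] {σ : E →+* E} {ϖ : E} {d t : ℕ}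

/-- In `ℤᵐ⁰`: `x·x ≤ exp(−2k) ⇒ x ≤ exp(−k)`. [cite: Serre1979, Ch. III §6 Prop. 12] -/
theorem le_exp_of_mul_self_le {x : ℤᵐ⁰} {k : ℤ} (h : x * x ≤ exp (-(2 * k))) : x ≤ exp (-k) := by
  rcases eq_or_ne x 0 with rfl | hx
  · exact zero_le
  · rw [← exp_log hx] at h ⊢
    rw [← exp_add, exp_le_exp] at h
    rw [exp_le_exp]
    omega

/-- In `ℤᵐ⁰`: `exp a < x ≤ exp (a + 1) ⇒ x = exp (a + 1)` (discreteness). [cite: Serre1979, Ch. III §6 Prop. 12] -/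
theorem eq_exp_of_lt_of_le {x : ℤᵐ⁰} {a : ℤ} (h1 : exp a < x) (h2 : x ≤ exp (a + 1)) : x = exp (a + 1) := by
  have hx : x ≠ 0 := fun h0 => by rw [h0] at h1; exact not_lt.2 zero_le h1
  rw [← exp_log hx] at h1 h2 ⊢
  rw [exp_lt_exp] at h1
  rw [exp_le_exp] at h2
  congr 1
  omega

/-- **THE SKEW GAIN OF THE RAMIFIED DATUM**: `|x − σx| ≤ |x|·|ϖ|^{d−1}` for every `x ∈ E` — write `x = a + bϖ` with `σ`-fixed `a, b` (★ `exists_fixed_coords_of_map_ne`);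
then `x − σx = b(ϖ − σϖ)` has valuation `|b|·|ϖ|^d`, while `|bϖ| ≤ |x|` because `|a|` and `|bϖ|` have opposite parities (★ `v_fixed_add_fixed_mul_eq_max`).
[cite: Serre1979, Ch. III §6 Prop. 13] -/
theorem v_sub_map_le_mul_of_datum (hD : IsRamifiedQuadraticDatum σ ϖ d t) (x : E) :
    Valued.v (x - σ x) ≤ Valued.v x * Valued.v ϖ ^ (d - 1) := by
  obtain ⟨hσ, _, hϖ, hfix, hd, h1d, _⟩ := hD
  obtain ⟨a, b, ha, hb, rfl⟩ := exists_fixed_coords_of_map_ne hσ (map_varpi_ne hϖ hd) x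
  have hsub : a + b * ϖ - σ (a + b * ϖ) = b * (ϖ - σ ϖ) := by rw [map_add, map_mul, ha, hb]; ring
  have hmax := v_fixed_add_fixed_mul_eq_max (even_log_v_of_fixed hfix) hϖ ha hb
  have hbϖ : Valued.v b * Valued.v ϖ ≤ Valued.v (a + b * ϖ) := by rw [hmax, hϖ]; exact le_max_right _ _
  have hpow : Valued.v ϖ ^ d = Valued.v ϖ * Valued.v ϖ ^ (d - 1) := by
    rw [← pow_succ']; congr 1; omega
  rw [hsub, map_mul, hd, hpow, ← mul_assoc]
  exact mul_le_mul' hbϖ le_rfl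

end Datum

section LineModel

variable {E : Type} {M : Type*} [Field E] [Valued E ℤᵐ⁰] [Field M] [Valued M ℤᵐ⁰] {σ : E →+* E} {ϖ : E} {d t : ℕ} {ρ Θ : M →+* M} {α : M}

/-- **THE SKEW GAIN IN THE LINE MODEL**: for a `ρ`-FIXED `X ∈ M` (so `X = jE x`, `ΘX = jE(σx)`), `|X − ΘX| ≤ |X|·|jE ϖ|^{d−1}` (`jE` isometric). [cite: Serre1979, Ch. III §6 Prop. 13] -/
theorem v_sub_map_le_mul_of_fixed (hD : IsRamifiedQuadraticDatum σ ϖ d t) (jE : E →+* M) (hjiso : ∀ a, Valued.v (jE a) = Valued.v a)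
    (hjfix : ∀ z, ρ z = z ↔ ∃ c, jE c = z) (hΘj : ∀ x, Θ (jE x) = jE (σ x)) {X : M} (hX : ρ X = X) :
    Valued.v (X - Θ X) ≤ Valued.v X * Valued.v (jE ϖ) ^ (d - 1) := by
  obtain ⟨x, rfl⟩ := (hjfix X).1 hX
  rw [hΘj, ← map_sub, hjiso, hjiso, hjiso]
  exact v_sub_map_le_mul_of_datum hD x

/-- `|x + ρx| ≤ |x|` (`ρ` isometric). [cite: Serre1979, Ch. III §3 Prop. 7] -/
theorem v_add_map_le (hvρ : ∀ x, Valued.v (ρ x) = Valued.v x) (x : M) : Valued.v (x + ρ x) ≤ Valued.v x :=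
  (Valuation.map_add _ _ _).trans (max_le le_rfl (by rw [hvρ]))

omit [Valued M ℤᵐ⁰] in
/-- `Tr_ρ` is `ρ`-invariant: `ρ(x + ρx) = x + ρx` for an involution `ρ`. [cite: Serre1979, Ch. III §3 Prop. 7] -/
theorem map_add_map_eq (hρρ : ∀ x, ρ (ρ x) = x) (x : M) : ρ (x + ρ x) = x + ρ x := by
  rw [map_add, hρρ, add_comm]

/-- `|jE ϖ ^ n| = exp(−n)` (`jE` isometric, `|ϖ| = exp(−1)`). [cite: Serre1979, Ch. III §6 Prop. 12] -/
theorem v_map_varpi_pow {ϖ : E} (hϖ : Valued.v ϖ = exp (-1 : ℤ)) (jE : E →+* M) (hjiso : ∀ a, Valued.v (jE a) = Valued.v a) (n : ℕ) :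
    Valued.v (jE ϖ ^ n) = exp (-(n : ℤ)) := by
  rw [map_pow, hjiso]; exact v_varpi_pow hϖ n

/-! ## §2 `ρ`-fixed coordinates of an order element: `ζ = A + B·α`, `B = (ζ − ρζ)∕(α − ρα)`, `A = ζ − B·α` -/

omit [Valued M ℤᵐ⁰] in
/-- The coordinates `B = (ζ − ρζ)∕(α − ρα)` and `A = ζ − B·α` are `ρ`-FIXED (`ρ` an involution). [cite: Serre1979, Ch. III §6 Prop. 12] -/
theorem coords_fixed (hρρ : ∀ x, ρ (ρ x) = x) (hα : ρ α ≠ α) (ζ : M) :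
    ρ ((ζ - ρ ζ) / (α - ρ α)) = (ζ - ρ ζ) / (α - ρ α) ∧ ρ (ζ - (ζ - ρ ζ) / (α - ρ α) * α) = ζ - (ζ - ρ ζ) / (α - ρ α) * α := by
  have hd : α - ρ α ≠ 0 := sub_ne_zero.2 (Ne.symm hα)
  have hB : ρ ((ζ - ρ ζ) / (α - ρ α)) = (ζ - ρ ζ) / (α - ρ α) := by
    rw [map_div₀, map_sub, map_sub, hρρ, hρρ, ← neg_sub ζ, ← neg_sub α, neg_div_neg_eq]
  refine ⟨hB, ?_⟩
  rw [map_sub, map_mul, hB]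
  have key : ζ - ρ ζ = (ζ - ρ ζ) / (α - ρ α) * (α - ρ α) := by rw [div_mul_cancel₀ _ hd]
  linear_combination (-1 : M) * key

/-- **SIZES OF THE COORDINATES of an element of `𝒪_j`**: `IsOrd ρ α cc ζ ⇒ |B| ≤ |cc|` and `|A| ≤ 1` (`|α| ≤ 1`, `|cc| ≤ 1`). [cite: Serre1979, Ch. III §6 Prop. 12] -/
theorem v_coords_le (hα : ρ α ≠ α) (hα1 : Valued.v α ≤ 1) {cc : M} (hcc : Valued.v cc ≤ 1) {ζ : M} (hζ : IsOrd ρ α cc ζ) :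
    Valued.v ((ζ - ρ ζ) / (α - ρ α)) ≤ Valued.v cc ∧ Valued.v (ζ - (ζ - ρ ζ) / (α - ρ α) * α) ≤ 1 := by
  have hd : α - ρ α ≠ 0 := sub_ne_zero.2 (Ne.symm hα)
  have hvd : Valued.v (α - ρ α) ≠ 0 := (Valuation.ne_zero_iff _).2 hd
  rw [isOrd_iff] at hζ
  have hB : Valued.v ((ζ - ρ ζ) / (α - ρ α)) ≤ Valued.v cc := by
    rw [map_div₀, div_le_iff₀ (zero_lt_iff.2 hvd), ← map_mul]
    exact hζ.2
  refine ⟨hB, (Valuation.map_sub _ _ _).trans (max_le hζ.1 ?_)⟩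
  rw [map_mul]
  exact mul_le_one' (hB.trans hcc) hα1

/-- **AN ELEMENT WITH SMALL `ρ`-FIXED COORDINATES LIES IN THE ORDER**: `ρA = A`, `ρB = B`, `|A| ≤ 1`, `|B| ≤ |cc|` (`|α| ≤ 1`, `|cc| ≤ 1`) `⇒ IsOrd ρ α cc (A + B·α)`.
[cite: Serre1979, Ch. III §6 Prop. 12] -/
theorem isOrd_of_coords (hα1 : Valued.v α ≤ 1) {cc : M} (hcc : Valued.v cc ≤ 1) {A B : M} (hA : ρ A = A) (hB : ρ B = B)
    (hA1 : Valued.v A ≤ 1) (hB1 : Valued.v B ≤ Valued.v cc) : IsOrd ρ α cc (A + B * α) := by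
  rw [isOrd_iff]
  refine ⟨(Valuation.map_add _ _ _).trans (max_le hA1 ?_), ?_⟩
  · rw [map_mul]; exact mul_le_one' (hB1.trans hcc) hα1
  · have e : A + B * α - ρ (A + B * α) = B * (α - ρ α) := by rw [map_add, map_mul, hA, hB]; ring
    rw [e, map_mul, map_mul]
    exact mul_le_mul' hB1 le_rfl

/-- A `ρ`-fixed integral element lies in every order `𝒪_j` (`|cc| ≤ 1` not even needed: its `B`-coordinate vanishes). [cite: Serre1979, Ch. III §6 Prop. 12] -/
theorem isOrd_of_fixed {cc A : M} (hA : ρ A = A) (hA1 : Valued.v A ≤ 1) : IsOrd ρ α cc A := by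
  rw [isOrd_iff, hA, sub_self, map_zero]
  exact ⟨hA1, zero_le⟩

/-! ## §3 The `κ` of a unimodular line: `|Tr_ρ(κα)| = |κ|` and `Tr_ρ(κ·𝒪_j)` is integral -/

/-- **`|Tr_ρ(κα)| = |κ|`** when `|κ + ρκ| ≤ 1 < |κ|` and `|α − ρα| = 1`: `κα + ρ(κα) = (κ + ρκ)α − ρκ·(α − ρα)`. [cite: Jacobowitz1962, §4] -/
theorem v_trace_mul_alpha_eq (hvρ : ∀ x, Valued.v (ρ x) = Valued.v x) (hα1 : Valued.v α ≤ 1) (hαρ : Valued.v (α - ρ α) = 1)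
    {κ : M} (hκρ : Valued.v (κ + ρ κ) ≤ 1) (hκ1 : 1 < Valued.v κ) : Valued.v (κ * α + ρ (κ * α)) = Valued.v κ := by
  have e : κ * α + ρ (κ * α) = -(ρ κ * (α - ρ α)) + (κ + ρ κ) * α := by rw [map_mul]; ring
  have hbig : Valued.v (-(ρ κ * (α - ρ α))) = Valued.v κ := by rw [Valuation.map_neg, map_mul, hvρ, hαρ, mul_one]
  have hsmall : Valued.v ((κ + ρ κ) * α) < Valued.v (-(ρ κ * (α - ρ α))) := by
    rw [hbig, map_mul]; exact lt_of_le_of_lt (mul_le_one' hκρ hα1) hκ1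
  rw [e, Valuation.map_add_eq_of_lt_left _ hsmall, hbig]

/-- **`Tr_ρ(κ·𝒪_j)` IS INTEGRAL**: with `|κ + ρκ| ≤ 1` and `|κ|·|cc| ≤ 1`, every `ζ ∈ 𝒪_j` has `|κζ + ρ(κζ)| ≤ 1` — in coordinates
`κζ + ρ(κζ) = A·Tr_ρ κ + B·Tr_ρ(κα)`. [cite: Jacobowitz1962, §4] -/
theorem v_trace_mul_le_one_of_isOrd (hρρ : ∀ x, ρ (ρ x) = x) (hvρ : ∀ x, Valued.v (ρ x) = Valued.v x) (hα : ρ α ≠ α) (hα1 : Valued.v α ≤ 1)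
    {cc : M} (hcc : Valued.v cc ≤ 1) {κ : M} (hκρ : Valued.v (κ + ρ κ) ≤ 1) (hκcc : Valued.v κ * Valued.v cc ≤ 1)
    {ζ : M} (hζ : IsOrd ρ α cc ζ) : Valued.v (κ * ζ + ρ (κ * ζ)) ≤ 1 := by
  obtain ⟨hB, hA⟩ := coords_fixed hρρ hα ζ
  obtain ⟨hB1, hA1⟩ := v_coords_le hα hα1 hcc hζ
  set B : M := (ζ - ρ ζ) / (α - ρ α)
  set A : M := ζ - B * α
  have hζAB : ζ = A + B * α := by simp [A]
  have e : κ * ζ + ρ (κ * ζ) = A * (κ + ρ κ) + B * (κ * α + ρ (κ * α)) := by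
    rw [hζAB, map_mul, map_add, map_mul, hA, hB, map_mul]; ring
  rw [e]
  refine (Valuation.map_add _ _ _).trans (max_le ?_ ?_)
  · rw [map_mul]; exact mul_le_one' hA1 hκρ
  · rw [map_mul]
    have hT : Valued.v (κ * α + ρ (κ * α)) ≤ Valued.v κ :=
      (v_add_map_le hvρ _).trans (by rw [map_mul]; exact mul_le_of_le_one_right' hα1)
    calc Valued.v B * Valued.v (κ * α + ρ (κ * α)) ≤ Valued.v cc * Valued.v κ := mul_le_mul' hB1 hT
      _ = Valued.v κ * Valued.v cc := mul_comm _ _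
      _ ≤ 1 := hκcc

/-! ## §4 The expansion of a value against its ray value, the depth trace, the token readings, and the three estimates -/

omit [Valued M ℤᵐ⁰] in
/-- **THE EXPANSION**: for `ζ = A + B·α` with `A, B, ΘA, ΘB` all `ρ`-fixed,
`Tr_ρ(c·ζΘζ) − AΘA·Tr_ρ(c) = BΘA·Tr_ρ(cα) + AΘB·Tr_ρ(cΘα) + BΘB·Tr_ρ(c·αΘα)`. [cite: Jacobowitz1962, §4] -/
theorem value_sub_ray_eq {A B : M} (hA : ρ A = A) (hB : ρ B = B) (hA' : ρ (Θ A) = Θ A) (hB' : ρ (Θ B) = Θ B) (c : M) :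
    c * ((A + B * α) * Θ (A + B * α)) + ρ (c * ((A + B * α) * Θ (A + B * α))) - A * Θ A * (c + ρ c) =
      B * Θ A * (c * α + ρ (c * α)) + A * Θ B * (c * Θ α + ρ (c * Θ α)) + B * Θ B * (c * (α * Θ α) + ρ (c * (α * Θ α))) := by
  simp only [map_add, map_mul, hA, hB, hA', hB']
  ring

omit [Valued M ℤᵐ⁰] in
/-- Regrouping of the cross term: `BΘA·P + AΘB·P′ = (BΘA·P − ΘB·A·P″) + AΘB·(P′ + P″)` (used with `P″ = ΘP`, so that the first bracket is `X − ΘX`, `X = BΘA·P`).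
[cite: Jacobowitz1962, §4] -/
theorem cross_regroup (A B A' B' P P' P'' : M) :
    B * A' * P + A * B' * P' = (B * A' * P - B' * A * P'') + A * B' * (P' + P'') := by ring

omit [Valued M ℤᵐ⁰] in
/-- `Θ Tr_ρ(cα) = Tr_ρ(Θc·Θα)` (`Θ` commutes with `ρ`). [cite: Jacobowitz1962, §4] -/
theorem map_trace_mul_eq (hΘρ : ∀ x, Θ (ρ x) = ρ (Θ x)) (c x : M) : Θ (c * x + ρ (c * x)) = Θ c * Θ x + ρ (Θ c * Θ x) := by
  rw [map_add, map_mul, hΘρ, map_mul]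

omit [Valued M ℤᵐ⁰] in
/-- `Tr_ρ(c·Θα) + Tr_ρ(Θc·Θα) = Tr_ρ((c + Θc)·Θα)`. [cite: Jacobowitz1962, §4] -/
theorem sum_traces_eq (c x : M) : (c * x + ρ (c * x)) + (Θ c * x + ρ (Θ c * x)) = (c + Θ c) * x + ρ ((c + Θ c) * x) := by
  rw [map_mul ρ (c + Θ c), map_add ρ c, map_mul, map_mul]; ring

omit [Valued E ℤᵐ⁰] [Valued M ℤᵐ⁰] in
/-- **THE DEPTH TRACE**: for `c = κμ`, `μ = lam − jE u₀`, `Θκ = κ`, `Θlam·lam = 1` and `Θ ∘ jE = jE ∘ σ`: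
`c + Θc = κ·((lam − 1)²·lam⁻¹ − jE((u₀ − 1) + σ(u₀ − 1)))`. [cite: Rogawski1990, §4.9 Prop. 4.9.1 (b) p. 55] -/
theorem depth_add_map_eq (jE : E →+* M) (hΘj : ∀ x, Θ (jE x) = jE (σ x)) {κ lam : M} (hΘκ : Θ κ = κ) (hlam : Θ lam * lam = 1) (u₀ : E) :
    κ * (lam - jE u₀) + Θ (κ * (lam - jE u₀)) = κ * ((lam - 1) ^ 2 * lam⁻¹ - jE ((u₀ - 1) + σ (u₀ - 1))) := by
  have hl0 : lam ≠ 0 := fun h0 => by rw [h0, mul_zero] at hlam; exact zero_ne_one hlam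
  have hΘlam : Θ lam = lam⁻¹ := eq_inv_of_mul_eq_one_left hlam
  rw [map_mul, hΘκ, map_sub Θ, hΘlam, hΘj]
  simp only [map_add, map_sub, map_one]
  field_simp
  ring

/-- `|κ| = exp(j)` from `|κ|·|jE ϖ|^j = 1`. [cite: Jacobowitz1962, §4] -/
theorem v_kappa_eq {ϖ : E} (hϖ : Valued.v ϖ = exp (-1 : ℤ)) (jE : E →+* M) (hjiso : ∀ a, Valued.v (jE a) = Valued.v a)
    {κ : M} {j : ℕ} (hκj : Valued.v κ * Valued.v (jE ϖ) ^ j = 1) : Valued.v κ = exp (j : ℤ) := by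
  rw [← map_pow, v_map_varpi_pow hϖ jE hjiso] at hκj
  have e : Valued.v κ = Valued.v κ * exp (-(j : ℤ)) * exp (j : ℤ) := by rw [mul_assoc, ← exp_add]; simp
  rw [e, hκj, one_mul]

/-- **THE SQUARE TOKEN READ AS A SIZE**: `IsOrd cc ((lam − 1)²∕jE ϖ^{2k}) ⇒ |lam − 1| ≤ exp(−k)`. [cite: Kottwitz1986BaseChangeUnits, §1 pp. 240–241] -/
theorem v_sub_one_le_of_sq {ϖ : E} (hϖ : Valued.v ϖ = exp (-1 : ℤ)) (jE : E →+* M) (hjiso : ∀ a, Valued.v (jE a) = Valued.v a)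
    {cc lam : M} {k : ℕ} (hsq : IsOrd ρ α cc ((lam - 1) ^ 2 / jE ϖ ^ (2 * k))) : Valued.v (lam - 1) ≤ exp (-(k : ℤ)) := by
  have hpow := v_map_varpi_pow hϖ jE hjiso (2 * k)
  have hne : Valued.v (jE ϖ ^ (2 * k)) ≠ 0 := by rw [hpow]; exact exp_ne_zero
  have h1 := ((isOrd_iff _ _ _ _).1 hsq).1
  rw [map_div₀, div_le_iff₀ (zero_lt_iff.2 hne), one_mul, hpow, map_pow, pow_two] at h1
  exact le_exp_of_mul_self_le (by push_cast at h1 ⊢; exact h1)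

/-- **THE DEPTH MULTIPLIER IS SMALL**: `|lam − jE u₀| ≤ exp(−k)` from `|lam − 1| ≤ exp(−k)`, `|u₀ − 1| ≤ |ϖ^m|`, `k ≤ m`. [cite: Rogawski1990, §4.9 Prop. 4.9.1 (b) p. 55] -/
theorem v_depth_le {ϖ : E} (hϖ : Valued.v ϖ = exp (-1 : ℤ)) (jE : E →+* M) (hjiso : ∀ a, Valued.v (jE a) = Valued.v a)
    {lam : M} {u₀ : E} {m k : ℕ} (hw : Valued.v (lam - 1) ≤ exp (-(k : ℤ))) (hum : Valued.v (u₀ - 1) ≤ Valued.v (ϖ ^ m)) (hF2 : k ≤ m) :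
    Valued.v (lam - jE u₀) ≤ exp (-(k : ℤ)) := by
  have e : lam - jE u₀ = (lam - 1) - jE (u₀ - 1) := by rw [map_sub, map_one]; ring
  rw [e]
  refine (Valuation.map_sub _ _ _).trans (max_le hw ?_)
  rw [hjiso]
  refine hum.trans ?_
  rw [map_pow, v_varpi_pow hϖ, exp_le_exp]
  omega

/-- `|lam| = 1` from `Θlam·lam = 1` (`Θ` isometric). [cite: Rogawski1990, §4.9 Prop. 4.9.1 (b) p. 55] -/
theorem v_lam_eq_one (hvΘ : ∀ x, Valued.v (Θ x) = Valued.v x) {lam : M} (hlam : Θ lam * lam = 1) : Valued.v lam = 1 := by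
  have h := congrArg Valued.v hlam
  rw [map_mul, hvΘ, map_one] at h
  exact Literature.NumberTheory.Automorphic.UnitaryLatticeTree.eq_one_of_mul_self_eq_one h

/-- **THE LEVEL TOKEN READ AS A SIZE**: `IsOrd cc ((lam − 1)∕jE ϖ^ℓ) ⇒ |(lam − 1) − ρ(lam − 1)| ≤ exp(−(ℓ + j))` (`cc = jE ϖ^j`, `|α − ρα| = 1`).
[cite: Kottwitz1986BaseChangeUnits, §1 pp. 240–241] -/
theorem v_sub_map_le_of_isOrd {ϖ : E} (hϖ : Valued.v ϖ = exp (-1 : ℤ)) (jE : E →+* M) (hjiso : ∀ a, Valued.v (jE a) = Valued.v a)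
    (hjfix : ∀ z, ρ z = z ↔ ∃ c, jE c = z) (hαρ : Valued.v (α - ρ α) = 1) {w : M} {j ℓ : ℕ}
    (h : IsOrd ρ α (jE ϖ ^ j) (w / jE ϖ ^ ℓ)) : Valued.v (w - ρ w) ≤ exp (-((ℓ : ℤ) + j)) := by
  have hρϖ : ρ (jE ϖ ^ ℓ) = jE ϖ ^ ℓ := by rw [map_pow, (hjfix _).2 ⟨ϖ, rfl⟩]
  have hpow := v_map_varpi_pow hϖ jE hjiso ℓ
  have hne : Valued.v (jE ϖ ^ ℓ) ≠ 0 := by rw [hpow]; exact exp_ne_zero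
  have h2 := ((isOrd_iff _ _ _ _).1 h).2
  rw [map_div₀, hρϖ, ← sub_div, map_div₀, div_le_iff₀ (zero_lt_iff.2 hne), map_mul, hαρ, mul_one, v_map_varpi_pow hϖ jE hjiso j, hpow,
    ← exp_add] at h2
  convert h2 using 2; ring

/-- **THE LOWER TOKEN READ AS SIZES**: if `(lam − 1)∕jE ϖ^{ℓ+1} ∉ 𝒪_j` while `|lam − 1| ≤ exp(−k)` with `ℓ + 1 ≤ k`, then the `α`-coordinate is what fails:
`exp(−(ℓ + 1 + j)) < |(lam − 1) − ρ(lam − 1)|`; in particular (as `|w − ρw| ≤ |w| ≤ exp(−k)`) `k ≤ j + ℓ`. [cite: Kottwitz1986BaseChangeUnits, §1 pp. 240–241] -/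
theorem lower_token_read {ϖ : E} (hϖ : Valued.v ϖ = exp (-1 : ℤ)) (jE : E →+* M) (hjiso : ∀ a, Valued.v (jE a) = Valued.v a)
    (hjfix : ∀ z, ρ z = z ↔ ∃ c, jE c = z) (hvρ : ∀ x, Valued.v (ρ x) = Valued.v x) (hαρ : Valued.v (α - ρ α) = 1) {w : M} {j ℓ k : ℕ}
    (hw : Valued.v w ≤ exp (-(k : ℤ))) (hℓk : ℓ + 1 ≤ k) (hn : ¬ IsOrd ρ α (jE ϖ ^ j) (w / jE ϖ ^ (ℓ + 1))) :
    exp (-((ℓ : ℤ) + 1 + j)) < Valued.v (w - ρ w) ∧ k ≤ j + ℓ := by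
  have hρϖ : ρ (jE ϖ ^ (ℓ + 1)) = jE ϖ ^ (ℓ + 1) := by rw [map_pow, (hjfix _).2 ⟨ϖ, rfl⟩]
  have hpow := v_map_varpi_pow hϖ jE hjiso (ℓ + 1)
  have hne : Valued.v (jE ϖ ^ (ℓ + 1)) ≠ 0 := by rw [hpow]; exact exp_ne_zero
  rw [isOrd_iff, not_and_or] at hn
  have hfirst : Valued.v (w / jE ϖ ^ (ℓ + 1)) ≤ 1 := by
    rw [map_div₀, div_le_iff₀ (zero_lt_iff.2 hne), one_mul, hpow]
    refine hw.trans ?_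
    rw [exp_le_exp]; push_cast; omega
  have hsecond : ¬ Valued.v (w / jE ϖ ^ (ℓ + 1) - ρ (w / jE ϖ ^ (ℓ + 1))) ≤ Valued.v (jE ϖ ^ j * (α - ρ α)) := by
    rcases hn with hn | hn
    · exact absurd hfirst hn
    · exact hn
  rw [map_div₀, hρϖ, ← sub_div, map_div₀, div_le_iff₀ (zero_lt_iff.2 hne), map_mul, hαρ, mul_one, v_map_varpi_pow hϖ jE hjiso j, hpow,
    ← exp_add, not_le] at hsecond
  have hlt : exp (-((ℓ : ℤ) + 1 + j)) < Valued.v (w - ρ w) := by convert hsecond using 2; push_cast; ring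
  refine ⟨hlt, ?_⟩
  have hle : Valued.v (w - ρ w) ≤ exp (-(k : ℤ)) := (Valuation.map_sub _ _ _).trans (max_le hw (by rw [hvρ]; exact hw))
  have := lt_of_lt_of_le hlt hle
  rw [exp_lt_exp] at this
  omega

end LineModel

end Summit.HodgeConjecture.HodgeConjecture.Cruxes.H413.F0P3cDyRamAxisLetterToolkit

end
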